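import Mathlib
import Literature.Analysis.FluidPDE.TypeIAncientMild
import Literature.Analysis.FluidPDE.TypeIAncientMildClassical
import Literature.Analysis.FluidPDE.BarkerPrange2020VorticityAlignmentTypeIHolds
import Literature.Analysis.FluidPDE.LocalBiotSavartCalculus
import Literature.Analysis.FluidPDE.VorticityFormulationHolds
import Literature.Analysis.FluidPDE.VectorCalculusProofs
import Literature.Analysis.FluidPDE.AxisymmetricVorticityTransport
import Literature.Analysis.FluidPDE.HelicityDensityPseudoscalar
import Summits.NavierStokesRegularity.NavierStokesRegularity.Theses.SymmetryModuliCount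
import Summits.NavierStokesRegularity.NavierStokesRegularity.Theorems.ClockStretchingLawClockCeilingGermRigidity
import Summits.NavierStokesRegularity.NavierStokesRegularity.Theorems.ClockStretchingLawClockLaw
import Summits.NavierStokesRegularity.NavierStokesRegularity.Theorems.ClockStretchingLawSteadySliceLiouvilleAnalytic
import Summits.NavierStokesRegularity.NavierStokesRegularity.Theorems.ScenarioCensusPeriodicGauge
import Summits.NavierStokesRegularity.NavierStokesRegularity.Theorems.ScenarioCensusForceMeter
import Summits.NavierStokesRegularity.NavierStokesRegularity.Theorems.SymmetryModuliCountFarPastLedger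
import Summits.NavierStokesRegularity.NavierStokesRegularity.Theorems.SymmetryModuliCountLinearLiouvilleSevenGaugeBounds
import Summits.NavierStokesRegularity.NavierStokesRegularity.Theorems.SymmetryModuliCountLinearLiouvilleSevenAnchorPressure
import Summits.NavierStokesRegularity.NavierStokesRegularity.Theorems.SymmetryModuliCountAxisymEndLiouville
import Summits.NavierStokesRegularity.NavierStokesRegularity.Theorems.SymmetryModuliCountHelicalEndLiouville
import Summits.NavierStokesRegularity.NavierStokesRegularity.Theorems.SymmetricLiouville.Negative.ScrewClause
import HarnessLib
import Summits.NavierStokesRegularity.NavierStokesRegularity.Theorems.ScenarioCensusRotationOrder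
import Summits.NavierStokesRegularity.NavierStokesRegularity.Theorems.ScenarioCensusGeneratorMeter
import Summits.NavierStokesRegularity.NavierStokesRegularity.Theorems.ScenarioCensusInertialMeter

/-!
# Block A2, instrument PATTERN METER (ns-idea-2 LINE g18-2; cells A2ptK / A2ptT / A2pwK / A2pwT / A2gkK / A2gkW DECIDED, A2ptP / A2ptS OPEN) — port, part 1/3: §0 the finite model (the Killing
# fields of `ℝ³`, axis vector, coordinates); §A analytic / differential helpers; §K THE KINEMATIC LAW (a Killing line PATTERN on a pocket forces the Killing SYMMETRY globally)

Re-homed for the scenario census (typer seat ns-census-typer-1 g10; the cells A2ptK / A2ptT / A2pwK / A2pwT / A2gkK / A2gkW are members of row A2 «DECIDED IN KERNEL IN FILES» (ns-idea-2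
g18 LINE g18-2; ref ns-census-ref g15 PRE-CHECK ✓ §20.20; critic / lead booking per the census), A2ptP / A2ptS OPEN (typed); this port makes the decided cells TREE-decided): VERBATIM
PORT of ns-idea-2 LINE g18-2 «pattern-meter», `pub/ideators/ns-idea-2/lines/pattern-meter/line-pattern-meter.lean` sha16 5ea38914a8b301c3 (1044 l., lean check rc 0, 0 sorry), split for
the 400-line rule into `ScenarioCensusPatternMeter` (§0, §A, §K) → `…PatternMeterKilling` (§N, §L, §V) → `…PatternMeterRows` (§C, §G + census KEYS).  Lean text VERBATIM in namespace
`…Theorems.ScenarioCensus.PatternMeter` (the line's `…Lines.PatternMeter` re-homed); port edits: the line's `local notation "E3"` is spelled as the reducible `abbrev E3` of every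
census file; §R (the line's VERBATIM reproduction of LINE «inertial-meter», namespace `Reproduced`) is NOT re-declared — the landed INERTIAL METER port is used BY NAME
(`InertialMeter.contDiff_two_slice` / `vorticityPocketRigidity` / `eq_zero_of_vorticityPeriodic_pocket`); elementary lemmas the line restates are the tree's BY NAME (gate lint
dedup.landed): `rotZ_two_pi` = `SymmetricLiouville.Negative.rotZ_two_pi` (ScrewClause), `rotZ_rotZ_neg` / `rotZ_neg_rotZ` = `RotationOrder.…`,
`analyticAt_clm_apply` = `GeneratorMeter.…`; `rotGenL_ne_zero` (twin of a lemma in a module outside this closure) is not re-declared, its proof is inlined at the use sites; `@[conjecture]` on the OPEN rows `Row_A2ptP`, `Row_A2ptS`; one-line docstrings added where missing (gate lint).  Statements untouched.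

No census VALUE is moved here (row A2 stays OPEN-WITH-LINE; the members become TREE-decided by name); (L′) is NOT proved; no summit statement is proved by this file. Lemmas that restate already-landed tree declarations are taken BY NAME (gate lint `dedup.landed`): `rotZ_two_pi` = `SymmetricLiouville.Negative.rotZ_two_pi`, `rotZ_rotZ_neg` = `RotationOrder.rotZ_rotZ_neg`, `rotZ_neg_rotZ` = `RotationOrder.rotZ_neg_rotZ`, `analyticAt_clm_apply` = `GeneratorMeter.analyticAt_clm_apply`.
-/

-- the summit and its single problem share the name `NavierStokesRegularity` (D-0017 nested layout)
set_option linter.dupNamespace false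

noncomputable section

open Set Function Filter Metric MeasureTheory InnerProductSpace
open scoped Topology RealInnerProductSpace
open Literature.Analysis Literature.Analysis.FluidPDE
open Summit.NavierStokesRegularity.NavierStokesRegularity.Theorems
open Summit.NavierStokesRegularity.NavierStokesRegularity.Theorems.ScenarioCensus
open Summit.NavierStokesRegularity.NavierStokesRegularity.Theorems.AxisymEndLiouville.AbsorbingAxisSwirlExtinction

namespace Summit.NavierStokesRegularity.NavierStokesRegularity.Theorems.ScenarioCensus.PatternMeter

/-- `ℝ³` (the line's `local notation "E3"`, spelled as a reducible abbreviation for the tree). -/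
abbrev E3 := EuclideanSpace ℝ (Fin 3)

-- the summit namespace `…NavierStokesRegularity.NavierStokesRegularity…` is the tree convention (D-0017)

variable {C C' : ℝ} {u v : ℝ → E3 → E3}

/-! ## 0. The finite model: the Killing fields of `ℝ³` (the Lie algebra `e(3)`), axis vector, coordinates -/

/-- The unit axial vector `e₃`. -/
def e₃ : E3 := EuclideanSpace.single 2 1

/-- The KILLING FIELD `k_{a,A,c}(x) = a + A (x − c)` (`A` skew): the infinitesimal generator of the
one-parameter group of rigid motions `s ↦ (x ↦ c + e^{sA}(x − c) + s a)`; its orbits are parallel LINES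
(`A = 0`), coaxial CIRCLES (`A ≠ 0`, no axial drift) or coaxial HELICES (`A ≠ 0`, axial drift). -/
def kil (a c : E3) (A : E3 →L[ℝ] E3) : E3 → E3 := fun x => a + A (x - c)

/-- The Killing field, unfolded. -/
theorem kil_apply (a c : E3) (A : E3 →L[ℝ] E3) (x : E3) : kil a c A x = a + A (x - c) := rfl

/-- The Killing field as translation plus rotation part. -/
theorem kil_eq (a c : E3) (A : E3 →L[ℝ] E3) : kil a c A = fun x => A x + (a - A c) := by
  funext x; simp only [kil, map_sub]; abel

/-- Derivative of a Killing field. -/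
theorem hasFDerivAt_kil (a c : E3) (A : E3 →L[ℝ] E3) (x : E3) : HasFDerivAt (kil a c A) A x := by
  rw [kil_eq]; exact A.hasFDerivAt.add_const _

/-- Killing fields are differentiable. -/
theorem differentiable_kil (a c : E3) (A : E3 →L[ℝ] E3) : Differentiable ℝ (kil a c A) :=
  fun x => (hasFDerivAt_kil a c A x).differentiableAt

/-- Killing fields are real-analytic. -/
theorem analyticOnNhd_kil (a c : E3) (A : E3 →L[ℝ] E3) : AnalyticOnNhd ℝ (kil a c A) univ := by
  rw [kil_eq]; exact fun x _ => (A.analyticAt x).add analyticAt_const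

/-- `tr A = 0` for a skew map: a Killing field is divergence free. -/
theorem sum_inner_skew {A : E3 →L[ℝ] E3} (hskew : ∀ x, ⟪A x, x⟫ = 0)
    (b : OrthonormalBasis (Fin 3) ℝ E3) : ∑ i, ⟪b i, A (b i)⟫ = 0 :=
  Finset.sum_eq_zero fun i _ => by rw [real_inner_comm]; exact hskew _

/-- Killing fields are divergence-free. -/
theorem divergence_kil {A : E3 →L[ℝ] E3} (hskew : ∀ x, ⟪A x, x⟫ = 0) (a c x : E3) :
    VectorCalculus.divergence (kil a c A) x = 0 := by
  rw [divergence_eq_sum_inner_fderiv (EuclideanSpace.basisFun (Fin 3) ℝ), (hasFDerivAt_kil a c A x).fderiv]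
  exact sum_inner_skew hskew _

/-- The rotation generator kills the axial direction. -/
theorem rotGen_add_smul_e₃ (v : E3) (r : ℝ) : rotGen (v + r • e₃) = rotGen v := by
  ext i; fin_cases i <;> simp [rotGen, e₃]

/-- `v + J(Jv)` is the axial component of `v`. -/
theorem self_add_rotGen_rotGen (v : E3) : v + rotGen (rotGen v) = (v 2) • e₃ := by
  ext i; fin_cases i <;> simp [rotGen, e₃]

-- `rotZ_two_pi`: the line restates the tree's `SymmetricLiouville.Negative.rotZ_two_pi`; taken BY NAME (gate lint dedup.landed).

-- `rotZ_rotZ_neg`: the line restates the tree's `RotationOrder.rotZ_rotZ_neg`; taken BY NAME (gate lint dedup.landed).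

-- `rotZ_neg_rotZ`: the line restates the tree's `RotationOrder.rotZ_neg_rotZ`; taken BY NAME (gate lint dedup.landed).

-- `e₃_ne_zero`: possibly read as a statement-twin of the landed `ScrewBlowdown.eZ_ne_zero` / Literature `η_ne_zero` (same shape `(c : E3) ≠ 0`); not re-declared — its two-line proof is inlined at the two use sites.

-- `rotGenL_ne_zero`: a statement-twin of the landed `SymmetricLiouville.Negative.rotGenL_ne_zero` (module `StubKinematics`, outside this file's import closure); not re-declared — its two-line proof is inlined at the two use sites.

/-- The screw orbit `s ↦ R_s y + (p s) e₃` has velocity `J(R_s y) + p e₃` — the Killing field `J x + p e₃`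
evaluated on the orbit (`J e₃ = 0`). -/
theorem hasDerivAt_screwOrbit (y : E3) (p s : ℝ) :
    HasDerivAt (fun s : ℝ => rotZ s y + (p * s) • e₃) (rotGen (rotZ s y) + p • e₃) s := by
  have h1 : HasDerivAt (fun s : ℝ => (p * s) • e₃) (p • e₃) s := by
    simpa using ((hasDerivAt_id s).const_mul p).smul_const e₃
  exact (hasDerivAt_rotZ_rotGen y s).fun_add h1

/-! ## A. Analytic / differential helpers -/

-- `analyticAt_clm_apply`: the line restates the tree's `GeneratorMeter.analyticAt_clm_apply`; taken BY NAME (gate lint dedup.landed).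

/-- `x ↦ ⟪f x, g x⟫` is analytic for analytic `f g`. -/
theorem analyticAt_inner' {X : Type*} [NormedAddCommGroup X] [NormedSpace ℝ X] {f g : X → E3} {x : X}
    (hf : AnalyticAt ℝ f x) (hg : AnalyticAt ℝ g x) : AnalyticAt ℝ (fun y => ⟪f y, g y⟫) x := by
  have hB : AnalyticAt ℝ (fun p : E3 × E3 => (innerSL ℝ : E3 →L[ℝ] E3 →L[ℝ] ℝ) p.1 p.2) (f x, g x) :=
    (innerSL ℝ : E3 →L[ℝ] E3 →L[ℝ] ℝ).analyticAt_bilinear (f x, g x)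
  have hP : AnalyticAt ℝ (fun y => (f y, g y)) x := hf.prod hg
  exact AnalyticAt.comp (f := fun y => (f y, g y)) (x := x) hB hP

/-- A differentiable field annihilated by a constant direction `a` is `a`-periodic (indeed invariant
along the lines `x + ℝ a`). -/
theorem periodic_of_fderiv_eq_zero {φ : E3 → E3} (hφ : Differentiable ℝ φ) (a : E3)
    (h : ∀ x, fderiv ℝ φ x a = 0) : ∀ x, φ (x + a) = φ x := by
  intro x
  set g : ℝ → E3 := fun s => φ (x + s • a) with hg
  have hline : ∀ s, HasDerivAt (fun s : ℝ => x + s • a) a s := fun s => by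
    simpa using ((hasDerivAt_id s).smul_const a).const_add x
  have hg' : ∀ s, HasDerivAt g 0 s := fun s => by
    have h1 := (hφ (x + s • a)).hasFDerivAt.comp_hasDerivAt s (hline s)
    rw [h (x + s • a)] at h1
    exact h1
  have hconst : g 1 = g 0 :=
    is_const_of_deriv_eq_zero (fun s => (hg' s).differentiableAt) (fun s => (hg' s).deriv) 1 0
  simpa [hg] using hconst

/-- The derivative of the conjugate field `z ↦ L φ(L⁻¹ z + c)` (re-proved; the tree's copy is private). -/
theorem fderiv_conj_apply (L : E3 ≃ₗᵢ[ℝ] E3) {φ : E3 → E3} (hd : Differentiable ℝ φ) (c y h : E3) :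
    fderiv ℝ (fun z => L (φ (L.symm z + c))) y h = L (fderiv ℝ φ (L.symm y + c) (L.symm h)) := by
  have h1 : HasFDerivAt (fun z : E3 => L.symm z + c)
      (L.symm.toContinuousLinearEquiv : E3 →L[ℝ] E3) y :=
    L.symm.toContinuousLinearEquiv.hasFDerivAt.add_const c
  have h2 : HasFDerivAt (fun z => φ (L.symm z + c))
      ((fderiv ℝ φ (L.symm y + c)).comp (L.symm.toContinuousLinearEquiv : E3 →L[ℝ] E3)) y :=
    (hd _).hasFDerivAt.comp y h1
  have h3 : HasFDerivAt (fun z => L (φ (L.symm z + c)))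
      ((L.toContinuousLinearEquiv : E3 →L[ℝ] E3).comp
        ((fderiv ℝ φ (L.symm y + c)).comp (L.symm.toContinuousLinearEquiv : E3 →L[ℝ] E3))) y :=
    L.toContinuousLinearEquiv.hasFDerivAt.comp y h2
  rw [h3.fderiv]; rfl

/-! ## K. THE KINEMATIC LAW: a Killing line PATTERN on a pocket forces the Killing SYMMETRY globally

The parallelism defect `P(x) = ‖k x‖² φ(x) − ⟪φ x, k x⟫ k(x)` of an analytic field against a Killing field is
analytic; it vanishes on the pocket, hence identically.  Where `k ≠ 0` this writes `φ = F k` with a smooth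
amplitude `F`; incompressibility `div φ = 0` and `div k = tr A = 0` give `k·∇F = 0`, whence the Lie bracket
`[k, φ] = Dφ·k − A φ = (k·∇F) k = 0`; on the zero set of `k` (a line or empty) by continuity and density. -/

/-- The parallelism defect of `φ` against `k`. -/
def parDefect (φ k : E3 → E3) (x : E3) : E3 := ⟪k x, k x⟫ • φ x - ⟪φ x, k x⟫ • k x

/-- The parallel defect of parallel vectors vanishes. -/
theorem parDefect_eq_zero_of_smul {φ k : E3 → E3} {x : E3} {r : ℝ} (h : φ x = r • k x) :
    parDefect φ k x = 0 := by
  rw [parDefect, h, real_inner_smul_left, smul_smul, mul_comm, sub_self]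

/-- The amplitude `F = ⟪φ, k⟫/‖k‖²` of a field parallel to `k` (meaningful where `k ≠ 0`). -/
def amp (φ k : E3 → E3) (y : E3) : ℝ := ⟪φ y, k y⟫ * (⟪k y, k y⟫)⁻¹

/-- The amplitude is differentiable. -/
theorem differentiableAt_amp {φ k : E3 → E3} {x : E3} (hφ : DifferentiableAt ℝ φ x)
    (hk : DifferentiableAt ℝ k x) (hx : k x ≠ 0) : DifferentiableAt ℝ (amp φ k) x := by
  unfold amp
  have hx' : ⟪k x, k x⟫ ≠ (0 : ℝ) := inner_self_ne_zero.2 hx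
  exact (hφ.inner ℝ hk).mul ((hk.inner ℝ hk).inv hx')

/-- Where `k ≠ 0`, a vanishing parallelism defect writes `φ = (amp φ k) • k`. -/
theorem eq_amp_smul_of_parDefect {φ k : E3 → E3} {y : E3} (hy : k y ≠ 0) (h0 : parDefect φ k y = 0) :
    φ y = amp φ k y • k y := by
  have hkk : ⟪k y, k y⟫ ≠ 0 := inner_self_ne_zero.2 hy
  rw [parDefect, sub_eq_zero] at h0
  calc φ y = ⟪k y, k y⟫⁻¹ • (⟪k y, k y⟫ • φ y) := by rw [smul_smul, inv_mul_cancel₀ hkk, one_smul]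
    _ = amp φ k y • k y := by rw [h0, smul_smul, amp, mul_comm]

/-- **Pattern ⇒ symmetry.**  An analytic divergence-free field on `ℝ³` which, on a nonempty open set, is
everywhere TANGENT to the Killing field `k(x) = a + A(x − c)` (`A` skew; free amplitude `f`), commutes
with it on all of `ℝ³`: `Dφ(x)[k(x)] = A φ(x)` for every `x`. -/
theorem lie_eq_of_pattern {φ : E3 → E3} (hφ : AnalyticOnNhd ℝ φ univ) (hdiv : VectorCalculus.IsDivFree φ)
    {A : E3 →L[ℝ] E3} (hskew : ∀ x, ⟪A x, x⟫ = 0) (a c : E3) {U : Set E3} (hU : IsOpen U)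
    (hne : U.Nonempty) {f : E3 → ℝ} (hpat : ∀ x ∈ U, φ x = f x • kil a c A x) :
    ∀ x, fderiv ℝ φ x (kil a c A x) = A (φ x) := by
  set k := kil a c A with hk
  -- Step 1: the parallelism defect vanishes identically
  have hka : AnalyticOnNhd ℝ k univ := analyticOnNhd_kil a c A
  have hPa : AnalyticOnNhd ℝ (parDefect φ k) univ := fun x hx =>
    ((analyticAt_inner' (hka x hx) (hka x hx)).smul (hφ x hx)).sub
      ((analyticAt_inner' (hφ x hx) (hka x hx)).smul (hka x hx))
  have hP0 : ∀ x, parDefect φ k x = 0 :=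
    ForceMeter.eq_zero_of_window hPa hU hne fun x hx => parDefect_eq_zero_of_smul (hpat x hx)
  -- regularity
  have hC1 : ContDiff ℝ 1 φ := contDiffOn_univ.1 (hφ.contDiffOn (n := 1) uniqueDiffOn_univ)
  have hφd : Differentiable ℝ φ := hC1.differentiable (by simp)
  have hkd : Differentiable ℝ k := differentiable_kil a c A
  -- Step 2: the bracket identity where `k ≠ 0`
  have hV : ∀ x, k x ≠ 0 → fderiv ℝ φ x (k x) = A (φ x) := by
    intro x hx
    have hopen : IsOpen {y : E3 | k y ≠ 0} := isOpen_ne_fun hkd.continuous continuous_const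
    have hrep : ∀ y, k y ≠ 0 → φ y = amp φ k y • k y := fun y hy =>
      eq_amp_smul_of_parDefect hy (hP0 y)
    have hev : φ =ᶠ[𝓝 x] fun y => amp φ k y • k y :=
      Filter.eventually_of_mem (hopen.mem_nhds hx) fun y hy => hrep y hy
    have hFd : DifferentiableAt ℝ (amp φ k) x := differentiableAt_amp (hφd x) (hkd x) hx
    have hprod : HasFDerivAt (fun y => amp φ k y • k y)
        (amp φ k x • A + (fderiv ℝ (amp φ k) x).smulRight (k x)) x :=
      hFd.hasFDerivAt.smul (hasFDerivAt_kil a c A x)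
    have hDφ : fderiv ℝ φ x = amp φ k x • A + (fderiv ℝ (amp φ k) x).smulRight (k x) := by
      rw [hev.fderiv_eq]; exact hprod.fderiv
    -- incompressibility: `k·∇F = 0`
    have hdivx : fderiv ℝ (amp φ k) x (k x) = 0 := by
      have h1 := hdiv x
      rw [divergence_eq_sum_inner_fderiv (EuclideanSpace.basisFun (Fin 3) ℝ), hDφ] at h1
      simp only [add_apply, smul_apply, ContinuousLinearMap.smulRight_apply, inner_add_right, real_inner_smul_right,
        Finset.sum_add_distrib] at h1
      rw [← Finset.mul_sum, sum_inner_skew hskew, mul_zero, zero_add] at h1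
      have e : ∑ i, (fderiv ℝ (amp φ k) x) ((EuclideanSpace.basisFun (Fin 3) ℝ) i) *
            ⟪(EuclideanSpace.basisFun (Fin 3) ℝ) i, k x⟫ = fderiv ℝ (amp φ k) x (k x) := by
        conv_rhs => rw [← (EuclideanSpace.basisFun (Fin 3) ℝ).sum_repr' (k x)]
        rw [map_sum]
        refine Finset.sum_congr rfl fun i _ => ?_
        rw [map_smul, smul_eq_mul, mul_comm]
      rwa [e] at h1
    rw [hDφ]
    simp only [add_apply, smul_apply, ContinuousLinearMap.smulRight_apply, hdivx, zero_smul, add_zero]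
    rw [hrep x hx, map_smul]
  -- Step 3: the zero set of `k`, by continuity and density
  intro x
  by_cases hx : k x ≠ 0
  · exact hV x hx
  have hx0 : k x = 0 := not_not.1 hx
  by_cases hA : A = 0
  · have : k x = a := by simp [hk, kil, hA]
    rw [hx0] at this
    rw [hx0, map_zero, hA]; rfl
  · obtain ⟨v, hv⟩ : ∃ v, A v ≠ 0 := by
      by_contra h
      exact hA (ContinuousLinearMap.ext fun v => by
        simpa using (not_not.1 fun hv => h ⟨v, hv⟩ : A v = 0))
    set G : E3 → E3 := fun y => fderiv ℝ φ y (k y) - A (φ y) with hG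
    have hGc : Continuous G :=
      ((hC1.continuous_fderiv (by simp)).clm_apply hkd.continuous).sub (A.continuous.comp hφd.continuous)
    have hline : ∀ s : ℝ, s ≠ 0 → G (x + s • v) = 0 := by
      intro s hs
      have hx0' : a + A (x - c) = 0 := hx0
      have hks : k (x + s • v) = s • A v := by
        show a + A (x + s • v - c) = s • A v
        rw [show x + s • v - c = (x - c) + s • v by abel, map_add, map_smul, ← add_assoc, hx0', zero_add]
      have hne' : k (x + s • v) ≠ 0 := by rw [hks]; exact smul_ne_zero hs hv
      simp only [hG]
      rw [sub_eq_zero]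
      exact hV _ hne'
    have hcl : IsClosed {s : ℝ | G (x + s • v) = 0} :=
      isClosed_eq (hGc.comp (continuous_const.add (continuous_id.smul continuous_const)))
        continuous_const
    have hsub : ({0}ᶜ : Set ℝ) ⊆ {s : ℝ | G (x + s • v) = 0} := fun s hs => hline s hs
    have hdense : Dense {s : ℝ | G (x + s • v) = 0} := (dense_compl_singleton 0).mono hsub
    have h0 : (0 : ℝ) ∈ {s : ℝ | G (x + s • v) = 0} := by
      rw [← hcl.closure_eq, hdense.closure_eq]; exact mem_univ _
    have : G x = 0 := by simpa using h0
    simpa [hG, sub_eq_zero] using this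

/-- The germ version of an infinitesimal Killing symmetry is the global one (analyticity). -/
theorem lie_eq_of_germ {φ : E3 → E3} (hφ : AnalyticOnNhd ℝ φ univ) (A : E3 →L[ℝ] E3) (a c : E3)
    {U : Set E3} (hU : IsOpen U) (hne : U.Nonempty)
    (hsym : ∀ x ∈ U, fderiv ℝ φ x (a + A (x - c)) = A (φ x)) :
    ∀ x, fderiv ℝ φ x (a + A (x - c)) = A (φ x) := by
  have hka : AnalyticOnNhd ℝ (kil a c A) univ := analyticOnNhd_kil a c A
  have hGa : AnalyticOnNhd ℝ (fun x => fderiv ℝ φ x (kil a c A x) - A (φ x)) univ := fun x hx =>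
    (GeneratorMeter.analyticAt_clm_apply (hφ.fderiv x hx) (hka x hx)).sub
      (GeneratorMeter.analyticAt_clm_apply (F := fun _ : E3 => A) analyticAt_const (hφ x hx))
  have h0 := ForceMeter.eq_zero_of_window hGa hU hne fun x hx => sub_eq_zero.2 (hsym x hx)
  exact fun x => sub_eq_zero.1 (h0 x)

end Summit.NavierStokesRegularity.NavierStokesRegularity.Theorems.ScenarioCensus.PatternMeter

end
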